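import Summits.HodgeConjecture.HodgeConjecture.Theorems.Ring2WeilCoverageRamifiedTypes
import Summits.HodgeConjecture.HodgeConjecture.Theorems.Ring2WeilCoverageRamifiedPrimePowers
import Summits.HodgeConjecture.HodgeConjecture.Theorems.Ring2WeilCoverageCyclotomicSignaturesG12D
import Summits.HodgeConjecture.HodgeConjecture.Theorems.Ring2WeilCoverageCyclotomicUnconditionalSqrtFive
import HarnessLib

/-!
# Weil-type family coverage — RAMIFIED TYPES AT THE `g = 12` LEVELS `35` AND `45` (ALL FOUR ROWS ARE NO ROWS): every
# `K`-balanced CM type of `ℚ(ζ₃₅)` (`K = ℚ(√−7), ℚ(√−35)`) carries a polarisation of type `𝔮₇` (`𝔮₇⁶ = (7)`, degree `49`,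
# `(1¹⁰, 7, 7)`), every `K`-balanced CM type of `ℚ(ζ₄₅)` (`K = ℚ(√−3), ℚ(√−15)`) one of type `𝔮₃` (`𝔮₃⁶ = (3)`, degree `9`,
# `(1¹⁰, 3, 3)`); dichotomies for all `2¹²` CM types

research route conditional on HC_CM; not a corollary; Q11.4-sentence-2 already refuted in dim ≥ 3.

Ring 2, WEIL-TYPE FAMILY-COVERAGE CENSUS (`HOME/WEIL-FAMILY-COVERAGE.md` `## b01`, blocks b01.27, b01.38 (the four NO rows
`(35, √−7)`, `(35, √−35)`, `(45, √−3)`, `(45, √−15)`; THEOREM L (i) by the quartic `√5` obstruction), part 48b (THEOREM L (ii) at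
35/45); owner ring2-b01), part 51 of the `Ring2WeilCoverage*` series (parts 48 / 48b / 48c):

* level `35`, `π = ζ³²(1 − ζ⁵)(1 − ζ)` (`ζ⁵` a primitive 7th root: `(π) = 𝔭₇`, `(π)⁶ = (7)`, `N(𝔬𝔣₀) = 7⁴`, degree `49`):
  `twistSet_thirtyFive` (`X_π = {2, 4, 9, 12, 17, 19, 22, 24, 27, 29, 32, 34}`, `|A_π|/2 = 7`), `map_type_pow_thirtyFive`,
  **`exists_type_thirtyFive_sqrt_neg_seven/_thirtyFive`** (+ `exists_ramifiedType_…`), **`exists_principal_xor_type_thirtyFive`**;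
* level `45`, `π = ζ⁴²(1 − ζ⁵)(1 − ζ)` (`ζ⁵` a primitive 9th root: `(π) = 𝔭₃`, `(π)⁶ = (3)`, `N(𝔬𝔣₀) = 3⁴`, degree `9`):
  `twistSet_fortyFive` (`X_π = {2, 7, 13, 16, 22, 26, 28, 31, 34, 37, 41, 44}`, `|A_π|/2 = 7`), `map_type_pow_fortyFive`,
  **`exists_type_fortyFive_sqrt_neg_three/_fifteen`** (+ `exists_ramifiedType_…`), **`exists_principal_xor_type_fortyFive`**.

So at 35/45, where NO `K`-balanced CM type is principally polarisable on `ℤ[ζ_M]`, EVERY one carries the ramified type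
(the primes over `5` — `(1 − ζ⁷)` at 35, `(1 − ζ⁹)` at 45, `|A|/2 = 7` — flip too; not spelled out).

HONEST FRAMING: torus-level statements about Shimura's divisors `X_ζ′` of type `(K; Φ; 𝔣₀)` on the principal CM torus
`ℂ^Φ/Φ(ℤ[ζ_M])` [Sh98 §14.3 Prop. 4–5] and elementary ideal arithmetic in `ℤ[ζ_M]`; all residue sets are displayed and checked
by `decide`; WHICH component of the Weil-type locus (split or not) carries the polarised point is NOT decided here — its
hermitian discriminant class is `N_{K⁺/ℚ}(𝔣₀)` times the type-independent determinant class of the torus' trace form modulo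
`Nm(K^×)`, split for some types and non-split for others (b01.17, exact periods: `A₃₆`'s degree-3 type lies on the split
`ℚ(√−3)` row, its degree-8 type on `R1 = (3, ℚ(√−3), 2)`); nothing here is a statement about Hodge classes,
`W_K`, general members or HC; `HC_CM` is used nowhere.  No `def`, no named fact, no `sorry`.

References: [cite: Shimura1998, §14.3 Prop. 4–5, pp. 103–104]; [cite: Washington1997, §8.1, Lemma 1.4, Prop. 2.8]; census
b01.17 / b01.34–b01.38 (seat-derived).
-/

noncomputable section

open Polynomial NumberField Complex Finset
open scoped Real nonZeroDivisors

namespace Summit.HodgeConjecture.Ring2WeilCoverage.RamifiedTypesLevels35and45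

open Literature.AlgebraicGeometry.Motives (CMType)
open Literature.AlgebraicGeometry.HodgeTheory (IsCMTypeSet)
open Literature.AlgebraicGeometry.ComplexMultiplication.CyclotomicCMType (isCMTypeSet_residueFilter)
open Literature.NumberTheory.ComplexMultiplication
open Summit.HodgeConjecture.Ring2WeilCoverage.RamifiedTypes
open Summit.HodgeConjecture.Ring2WeilCoverage.RamifiedPrimePowers
open Summit.HodgeConjecture.Ring2WeilCoverage.CyclotomicUnitProducts (isUnit_one_sub_toInteger_pow)
open Summit.HodgeConjecture.Ring2WeilCoverage.CMTypeSetPairCount (card_inter_add_card_inter_eq)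
open Summit.HodgeConjecture.Ring2WeilCoverage.CMTypeSetOddPositions (two_mul_card_eq_card_units)
open Summit.HodgeConjecture.Ring2WeilCoverage.CyclotomicSignaturesG12D (exists_units_sign_eq_thirtyFive exists_units_sign_eq_fortyFive)
open Summit.HodgeConjecture.Ring2WeilCoverage.CyclotomicUnconditionalSqrtFive (norm_realUnits_pos_thirtyFive norm_realUnits_pos_fortyFive)

variable {K : Type} [Field K] [NumberField K] {ζ : K}

/-- `𝐞(t) = exp(2πi t/n) ∈ ℂ` (`ZMod.toCircle`). -/
local notation3 (prettyPrint := false) "𝐞 " t:max => ((ZMod.toCircle t : Circle) : ℂ)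

section Level35

/-- the residue set `S_Φ` read at level `35`. -/
local notation3 (prettyPrint := false) "SΦ[" Φ "," z "]" =>
  (Finset.univ.filter fun t : ZMod 35 => ∃ σ ∈ (Φ : CMType K).1, σ (z : K) = 𝐞 t)

/-- part 48's twisted sign set `X_π` at level `35` (`n := 35`). -/
local notation3 (prettyPrint := false) "Xtw35 " x:max =>
  (Finset.univ.filter fun t : ZMod 35 => t.val.Coprime 35 ∧
    ¬ ((35 < (x : ℕ × ℕ × ℕ).1 * ZMod.val t % (2 * 35) ↔ 35 < (x : ℕ × ℕ × ℕ).2.1 * ZMod.val t % (2 * 35)) ↔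
      Even (Finset.card (Finset.filter (fun s : ZMod 35 => s.val.Coprime 35 ∧ s.val < t.val) Finset.univ))))

/-- the census's `N_odd` at level `35` (part 5). -/
local notation3 (prettyPrint := false) "Nodd35" =>
  (Finset.univ.filter fun t : ZMod 35 => t.val.Coprime 35 ∧
    Even (Finset.card (Finset.filter (fun s : ZMod 35 => s.val.Coprime 35 ∧ s.val < t.val) Finset.univ)))

/-- **`N_odd(35) = [1, 3, 6, 9, 12, 16, 18, 22, 24, 27, 31, 33]`** (`decide`). [folklore] -/
theorem nodd_thirtyFive_eq : Nodd35 = ({1, 3, 6, 9, 12, 16, 18, 22, 24, 27, 31, 33} : Finset (ZMod 35)) := by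
  decide

/-! #### Level `35`, the type `𝔣₀` with `𝔬𝔣₀ = (π)`, `π = ζ^32(1 − ζ^5)(1 − ζ^1)` (`ζ^5` a primitive `7`-th root of unity: `(π) = (1 − ζ^5)`, `(π)^6 = (7)`) -/

/-- the semi-admissibility of `x = (5, 1, 32)` at level `35` (`35 ∤ 5, 1`; `2·32 + 5 + 1 ≡ 0 (mod 70)`). [folklore] -/
theorem adm_thirtyFive : ¬ 35 ∣ ((5, 1, 32) : ℕ × ℕ × ℕ).1 ∧ ¬ 35 ∣ ((5, 1, 32) : ℕ × ℕ × ℕ).2.1 ∧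
    (2 * ((5, 1, 32) : ℕ × ℕ × ℕ).2.2 + ((5, 1, 32) : ℕ × ℕ × ℕ).1 + ((5, 1, 32) : ℕ × ℕ × ℕ).2.1) % (2 * 35) = 0 := by
  decide

/-- **The twisted sign set at level `35` for `π = ζ^32(1 − ζ^5)(1 − ζ^1)`: `X_π = N_odd ∆ A_π = [2, 4, 9, 12, 17, 19, 22, 24, 27, 29, 32, 34]`** (`A_π = [1, 2, 3, 4, 6, 16, 17, 18, 19, 29, 31, 32, 33, 34]`, `|A_π|/2 = 7`;
`decide`).
research route conditional on HC_CM; not a corollary; Q11.4-sentence-2 already refuted in dim ≥ 3. [folklore] -/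
theorem twistSet_thirtyFive : Xtw35 ((5, 1, 32) : ℕ × ℕ × ℕ) = ({2, 4, 9, 12, 17, 19, 22, 24, 27, 29, 32, 34} : Finset (ZMod 35)) := by
  decide

/-- **A type `𝔣₀ ⊆ 𝓞 K⁺` with `𝔬𝔣₀ = (π)`, `π = ζ^32(1 − ζ^5)(1 − ζ^1)`, EXISTS** (part 48 `exists_ideal_map_eq_span_gen`).
research route conditional on HC_CM; not a corollary; Q11.4-sentence-2 already refuted in dim ≥ 3. [cite: Shimura1998, §14.3, p. 103] -/
theorem exists_type_ideal_thirtyFive [IsCMField K] (hζ : IsPrimitiveRoot ζ 35) :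
    ∃ 𝔣₀ : Ideal (𝓞 (maximalRealSubfield K)),
      𝔣₀.map (algebraMap (𝓞 (maximalRealSubfield K)) (𝓞 K)) = Ideal.span {hζ.toInteger ^ 32 * (1 - hζ.toInteger ^ 5) * (1 - hζ.toInteger ^ 1)} :=
  exists_ideal_map_eq_span_gen (x := ((5, 1, 32) : ℕ × ℕ × ℕ)) hζ adm_thirtyFive

omit [NumberField K] in
/-- **`(𝔬𝔣₀)^6 = (7)`** for the type `𝔣₀` with `𝔬𝔣₀ = (π)`, `π = ζ^32(1 − ζ^5)(1 − ζ^1)`: `(π) = (1 − ζ^5)` (the factors `ζ^32`,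
`1 − ζ^1` are units, part 13) and `(1 − ζ^5)^6 = (7)` (part 48c, `ζ^5` a primitive `7`-th root of unity) — so
`N(𝔬𝔣₀) = 7^4`, `N_{K⁺/ℚ}(𝔣₀) = 7^2`: a polarisation of type `𝔣₀` on `ℂ^Φ/Φ(ℤ[ζ_35])` has degree `49`.
research route conditional on HC_CM; not a corollary; Q11.4-sentence-2 already refuted in dim ≥ 3. [cite: Washington1997, Lemma 1.4, Prop. 2.8] -/
theorem map_type_pow_thirtyFive (hζ : IsPrimitiveRoot ζ 35) {𝔣₀ : Ideal (𝓞 (maximalRealSubfield K))}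
    (h𝔣₀ : 𝔣₀.map (algebraMap (𝓞 (maximalRealSubfield K)) (𝓞 K)) = Ideal.span {hζ.toInteger ^ 32 * (1 - hζ.toInteger ^ 5) * (1 - hζ.toInteger ^ 1)}) :
    𝔣₀.map (algebraMap (𝓞 (maximalRealSubfield K)) (𝓞 K)) ^ 6 = Ideal.span {(7 : 𝓞 K)} := by
  have hη : IsPrimitiveRoot (ζ ^ 5) 7 := hζ.pow (by norm_num) (by norm_num)
  have hηint : hη.toInteger = hζ.toInteger ^ 5 := RingOfIntegers.ext (by simp [IsPrimitiveRoot.toInteger])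
  have hu1 : IsUnit (hζ.toInteger ^ 32 : 𝓞 K) := (hζ.toInteger_isPrimitiveRoot.isUnit (by norm_num)).pow 32
  have hu2 : IsUnit (1 - hζ.toInteger ^ 1 : 𝓞 K) := isUnit_one_sub_toInteger_pow hζ (by decide) (by decide +kernel)
  rw [h𝔣₀, Ideal.span_singleton_mul_right_unit hu2, Ideal.span_singleton_mul_left_unit hu1, ← hηint]
  exact span_one_sub_pow_eq_seven hη

open scoped Classical in
/-- **CENSUS ROW `(ℚ(ζ_35), ℚ(√−7))` (a NO row for principal polarisations) — the RAMIFIED TYPE EXISTS: for every CM type `Φ`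
of `ℚ(ζ_35)` balanced for `N_K = [3, 6, 12, 13, 17, 19, 24, 26, 27, 31, 33, 34]` (the Weil signature `(6,6)` on `K = ℚ(√−7)`) and every type `𝔣₀` with
`𝔬𝔣₀ = (π)`, `π = ζ^32(1 − ζ^5)(1 − ζ^1)`, the principal CM torus `ℂ^Φ/Φ(ℤ[ζ_35])` CARRIES a `Φ`-positive divisor `X_ζ′` of type
`(K; Φ; 𝔣₀)`** — `ζ′^ρ = −ζ′`, `Im φ(ζ′) > 0` on `Φ`, `IsOfType 1 ζ′ 𝔣₀` [Sh98 §14.3 Prop. 4: a polarisation whose `φ_X` is the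
`𝔬𝔣₀`-multiplication, of degree `49`].  Proof: part 48 `exists_type_of_even` + THEOREM L (ii) at `35` + the residue count
`|S_Φ ∩ X_π| ≡ |X_π ∖ N_K| + g/2 = 6 + 6 ≡ 0`.
research route conditional on HC_CM; not a corollary; Q11.4-sentence-2 already refuted in dim ≥ 3. [cite: Shimura1998, §14.3 Prop. 4–5, pp. 103–104] -/
theorem exists_type_thirtyFive_sqrt_neg_seven [IsCMField K] [IsCyclotomicExtension {35} ℚ K] (hζ : IsPrimitiveRoot ζ 35)
    (Φ : CMType K) (hbal : 2 * (SΦ[Φ, ζ] ∩ ({3, 6, 12, 13, 17, 19, 24, 26, 27, 31, 33, 34} : Finset (ZMod 35))).card = (SΦ[Φ, ζ]).card)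
    {𝔣₀ : Ideal (𝓞 (maximalRealSubfield K))}
    (h𝔣₀ : 𝔣₀.map (algebraMap (𝓞 (maximalRealSubfield K)) (𝓞 K)) = Ideal.span {hζ.toInteger ^ 32 * (1 - hζ.toInteger ^ 5) * (1 - hζ.toInteger ^ 1)}) :
    ∃ ζ' : K, IsCMField.complexConj K ζ' = -ζ' ∧ (∀ φ : Φ.1, 0 < (φ.1 ζ').im) ∧
        CMTypeLattice.IsOfType (1 : (FractionalIdeal (𝓞 K)⁰ K)ˣ) ζ' 𝔣₀ := by
  have hg : Nat.totient 35 = 2 * (11 + 1) := by decide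
  refine exists_type_of_even hζ hg adm_thirtyFive Φ h𝔣₀ (exists_units_sign_eq_thirtyFive hζ Φ) ?_
  rw [twistSet_thirtyFive]
  have hS := isCMTypeSet_residueFilter hζ Φ
  have hX : IsCMTypeSet 35 ({2, 4, 9, 12, 17, 19, 22, 24, 27, 29, 32, 34} : Finset (ZMod 35)) := by decide
  have hNK : IsCMTypeSet 35 ({3, 6, 12, 13, 17, 19, 24, 26, 27, 31, 33, 34} : Finset (ZMod 35)) := by decide
  have h1 := card_inter_mod_two_eq hS hX hNK
  have h2 := two_mul_card_eq_card_units hS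
  have hU : (Finset.univ.filter fun t : ZMod 35 => t.val.Coprime 35).card = 24 := by decide
  have h3 : (({2, 4, 9, 12, 17, 19, 22, 24, 27, 29, 32, 34} : Finset (ZMod 35)) \ ({3, 6, 12, 13, 17, 19, 24, 26, 27, 31, 33, 34} : Finset (ZMod 35))).card = 6 := by decide
  rw [Nat.even_iff]
  omega

open scoped Classical in
/-- **CENSUS ROW `(ℚ(ζ_35), ℚ(√−7))`, headline form: there is a type `𝔣₀ ⊆ 𝓞 K⁺` with `(𝔬𝔣₀)^6 = (7)` such that
`ℂ^Φ/Φ(ℤ[ζ_35])` carries a `Φ`-positive divisor of type `(K; Φ; 𝔣₀)`** for every `K`-balanced CM type `Φ`, `K = ℚ(√−7)`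
(polarisation degree `49`; the census's NO row gets an explicit NON-principal polarisation).
research route conditional on HC_CM; not a corollary; Q11.4-sentence-2 already refuted in dim ≥ 3. [cite: Shimura1998, §14.3 Prop. 4–5, pp. 103–104] -/
theorem exists_ramifiedType_thirtyFive_sqrt_neg_seven [IsCMField K] [IsCyclotomicExtension {35} ℚ K]
    (hζ : IsPrimitiveRoot ζ 35) (Φ : CMType K) (hbal : 2 * (SΦ[Φ, ζ] ∩ ({3, 6, 12, 13, 17, 19, 24, 26, 27, 31, 33, 34} : Finset (ZMod 35))).card = (SΦ[Φ, ζ]).card) :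
    ∃ 𝔣₀ : Ideal (𝓞 (maximalRealSubfield K)),
      𝔣₀.map (algebraMap (𝓞 (maximalRealSubfield K)) (𝓞 K)) ^ 6 = Ideal.span {(7 : 𝓞 K)} ∧
      ∃ ζ' : K, IsCMField.complexConj K ζ' = -ζ' ∧ (∀ φ : Φ.1, 0 < (φ.1 ζ').im) ∧
        CMTypeLattice.IsOfType (1 : (FractionalIdeal (𝓞 K)⁰ K)ˣ) ζ' 𝔣₀ := by
  obtain ⟨𝔣₀, h𝔣₀⟩ := exists_type_ideal_thirtyFive hζ
  exact ⟨𝔣₀, map_type_pow_thirtyFive hζ h𝔣₀, exists_type_thirtyFive_sqrt_neg_seven hζ Φ hbal h𝔣₀⟩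

open scoped Classical in
/-- **CENSUS ROW `(ℚ(ζ_35), ℚ(√−35))` (a NO row for principal polarisations) — the RAMIFIED TYPE EXISTS: for every CM type `Φ`
of `ℚ(ζ_35)` balanced for `N_K = [2, 6, 8, 18, 19, 22, 23, 24, 26, 31, 32, 34]` (the Weil signature `(6,6)` on `K = ℚ(√−35)`) and every type `𝔣₀` with
`𝔬𝔣₀ = (π)`, `π = ζ^32(1 − ζ^5)(1 − ζ^1)`, the principal CM torus `ℂ^Φ/Φ(ℤ[ζ_35])` CARRIES a `Φ`-positive divisor `X_ζ′` of type
`(K; Φ; 𝔣₀)`** — `ζ′^ρ = −ζ′`, `Im φ(ζ′) > 0` on `Φ`, `IsOfType 1 ζ′ 𝔣₀` [Sh98 §14.3 Prop. 4: a polarisation whose `φ_X` is the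
`𝔬𝔣₀`-multiplication, of degree `49`].  Proof: part 48 `exists_type_of_even` + THEOREM L (ii) at `35` + the residue count
`|S_Φ ∩ X_π| ≡ |X_π ∖ N_K| + g/2 = 6 + 6 ≡ 0`.
research route conditional on HC_CM; not a corollary; Q11.4-sentence-2 already refuted in dim ≥ 3. [cite: Shimura1998, §14.3 Prop. 4–5, pp. 103–104] -/
theorem exists_type_thirtyFive_sqrt_neg_thirtyFive [IsCMField K] [IsCyclotomicExtension {35} ℚ K] (hζ : IsPrimitiveRoot ζ 35)
    (Φ : CMType K) (hbal : 2 * (SΦ[Φ, ζ] ∩ ({2, 6, 8, 18, 19, 22, 23, 24, 26, 31, 32, 34} : Finset (ZMod 35))).card = (SΦ[Φ, ζ]).card)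
    {𝔣₀ : Ideal (𝓞 (maximalRealSubfield K))}
    (h𝔣₀ : 𝔣₀.map (algebraMap (𝓞 (maximalRealSubfield K)) (𝓞 K)) = Ideal.span {hζ.toInteger ^ 32 * (1 - hζ.toInteger ^ 5) * (1 - hζ.toInteger ^ 1)}) :
    ∃ ζ' : K, IsCMField.complexConj K ζ' = -ζ' ∧ (∀ φ : Φ.1, 0 < (φ.1 ζ').im) ∧
        CMTypeLattice.IsOfType (1 : (FractionalIdeal (𝓞 K)⁰ K)ˣ) ζ' 𝔣₀ := by
  have hg : Nat.totient 35 = 2 * (11 + 1) := by decide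
  refine exists_type_of_even hζ hg adm_thirtyFive Φ h𝔣₀ (exists_units_sign_eq_thirtyFive hζ Φ) ?_
  rw [twistSet_thirtyFive]
  have hS := isCMTypeSet_residueFilter hζ Φ
  have hX : IsCMTypeSet 35 ({2, 4, 9, 12, 17, 19, 22, 24, 27, 29, 32, 34} : Finset (ZMod 35)) := by decide
  have hNK : IsCMTypeSet 35 ({2, 6, 8, 18, 19, 22, 23, 24, 26, 31, 32, 34} : Finset (ZMod 35)) := by decide
  have h1 := card_inter_mod_two_eq hS hX hNK
  have h2 := two_mul_card_eq_card_units hS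
  have hU : (Finset.univ.filter fun t : ZMod 35 => t.val.Coprime 35).card = 24 := by decide
  have h3 : (({2, 4, 9, 12, 17, 19, 22, 24, 27, 29, 32, 34} : Finset (ZMod 35)) \ ({2, 6, 8, 18, 19, 22, 23, 24, 26, 31, 32, 34} : Finset (ZMod 35))).card = 6 := by decide
  rw [Nat.even_iff]
  omega

open scoped Classical in
/-- **CENSUS ROW `(ℚ(ζ_35), ℚ(√−35))`, headline form: there is a type `𝔣₀ ⊆ 𝓞 K⁺` with `(𝔬𝔣₀)^6 = (7)` such that
`ℂ^Φ/Φ(ℤ[ζ_35])` carries a `Φ`-positive divisor of type `(K; Φ; 𝔣₀)`** for every `K`-balanced CM type `Φ`, `K = ℚ(√−35)`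
(polarisation degree `49`; the census's NO row gets an explicit NON-principal polarisation).
research route conditional on HC_CM; not a corollary; Q11.4-sentence-2 already refuted in dim ≥ 3. [cite: Shimura1998, §14.3 Prop. 4–5, pp. 103–104] -/
theorem exists_ramifiedType_thirtyFive_sqrt_neg_thirtyFive [IsCMField K] [IsCyclotomicExtension {35} ℚ K]
    (hζ : IsPrimitiveRoot ζ 35) (Φ : CMType K) (hbal : 2 * (SΦ[Φ, ζ] ∩ ({2, 6, 8, 18, 19, 22, 23, 24, 26, 31, 32, 34} : Finset (ZMod 35))).card = (SΦ[Φ, ζ]).card) :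
    ∃ 𝔣₀ : Ideal (𝓞 (maximalRealSubfield K)),
      𝔣₀.map (algebraMap (𝓞 (maximalRealSubfield K)) (𝓞 K)) ^ 6 = Ideal.span {(7 : 𝓞 K)} ∧
      ∃ ζ' : K, IsCMField.complexConj K ζ' = -ζ' ∧ (∀ φ : Φ.1, 0 < (φ.1 ζ').im) ∧
        CMTypeLattice.IsOfType (1 : (FractionalIdeal (𝓞 K)⁰ K)ˣ) ζ' 𝔣₀ := by
  obtain ⟨𝔣₀, h𝔣₀⟩ := exists_type_ideal_thirtyFive hζ
  exact ⟨𝔣₀, map_type_pow_thirtyFive hζ h𝔣₀, exists_type_thirtyFive_sqrt_neg_thirtyFive hζ Φ hbal h𝔣₀⟩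

open scoped Classical in
/-- **DICHOTOMY AT LEVEL `35`: every one of the `2^12` CM types `Φ` of `ℚ(ζ_35)` makes `ℂ^Φ/Φ(ℤ[ζ_35])` carry EITHER an
`ι`-compatible principal polarisation OR a `Φ`-positive divisor of the ramified type `𝔣₀` (`𝔬𝔣₀ = (π)`, `π = ζ^32(1 − ζ^5)(1 − ζ^1)`),
NEVER BOTH** — `|N_odd ∖ X_π| = |A_π|/2 = 7` is odd (equivalently `N_{K⁺/ℚ}(π) < 0`), THEOREM L (i)/(ii) at `35`, part 48
`exists_principal_xor_exists_type`.
research route conditional on HC_CM; not a corollary; Q11.4-sentence-2 already refuted in dim ≥ 3. [cite: Shimura1998, §14.3 Prop. 5, p. 104] -/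
theorem exists_principal_xor_type_thirtyFive [IsCMField K] [IsCyclotomicExtension {35} ℚ K] (hζ : IsPrimitiveRoot ζ 35)
    (Φ : CMType K) {𝔣₀ : Ideal (𝓞 (maximalRealSubfield K))}
    (h𝔣₀ : 𝔣₀.map (algebraMap (𝓞 (maximalRealSubfield K)) (𝓞 K)) = Ideal.span {hζ.toInteger ^ 32 * (1 - hζ.toInteger ^ 5) * (1 - hζ.toInteger ^ 1)}) :
    Xor (∃ ζ' : K, IsCMField.complexConj K ζ' = -ζ' ∧ (∀ φ : Φ.1, 0 < (φ.1 ζ').im) ∧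
          CMTypeLattice.IsOfType (1 : (FractionalIdeal (𝓞 K)⁰ K)ˣ) ζ' ⊤)
      (∃ ζ' : K, IsCMField.complexConj K ζ' = -ζ' ∧ (∀ φ : Φ.1, 0 < (φ.1 ζ').im) ∧
          CMTypeLattice.IsOfType (1 : (FractionalIdeal (𝓞 K)⁰ K)ˣ) ζ' 𝔣₀) := by
  have hg : Nat.totient 35 = 2 * (11 + 1) := by decide
  refine exists_principal_xor_exists_type hζ hg adm_thirtyFive Φ h𝔣₀ (norm_realUnits_pos_thirtyFive hζ)
    (exists_units_sign_eq_thirtyFive hζ Φ) ?_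
  rw [twistSet_thirtyFive, nodd_thirtyFive_eq]
  have hS := isCMTypeSet_residueFilter hζ Φ
  have hN : IsCMTypeSet 35 ({1, 3, 6, 9, 12, 16, 18, 22, 24, 27, 31, 33} : Finset (ZMod 35)) := by decide
  have hX : IsCMTypeSet 35 ({2, 4, 9, 12, 17, 19, 22, 24, 27, 29, 32, 34} : Finset (ZMod 35)) := by decide
  have h := card_inter_add_card_inter_eq hS hN hX
  have hd : (({1, 3, 6, 9, 12, 16, 18, 22, 24, 27, 31, 33} : Finset (ZMod 35)) \ ({2, 4, 9, 12, 17, 19, 22, 24, 27, 29, 32, 34} : Finset (ZMod 35))).card = 7 := by decide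
  omega

end Level35

section Level45

/-- the residue set `S_Φ` read at level `45`. -/
local notation3 (prettyPrint := false) "SΦ[" Φ "," z "]" =>
  (Finset.univ.filter fun t : ZMod 45 => ∃ σ ∈ (Φ : CMType K).1, σ (z : K) = 𝐞 t)

/-- part 48's twisted sign set `X_π` at level `45` (`n := 45`). -/
local notation3 (prettyPrint := false) "Xtw45 " x:max =>
  (Finset.univ.filter fun t : ZMod 45 => t.val.Coprime 45 ∧
    ¬ ((45 < (x : ℕ × ℕ × ℕ).1 * ZMod.val t % (2 * 45) ↔ 45 < (x : ℕ × ℕ × ℕ).2.1 * ZMod.val t % (2 * 45)) ↔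
      Even (Finset.card (Finset.filter (fun s : ZMod 45 => s.val.Coprime 45 ∧ s.val < t.val) Finset.univ))))

/-- the census's `N_odd` at level `45` (part 5). -/
local notation3 (prettyPrint := false) "Nodd45" =>
  (Finset.univ.filter fun t : ZMod 45 => t.val.Coprime 45 ∧
    Even (Finset.card (Finset.filter (fun s : ZMod 45 => s.val.Coprime 45 ∧ s.val < t.val) Finset.univ)))

/-- **`N_odd(45) = [1, 4, 8, 13, 16, 19, 23, 28, 31, 34, 38, 43]`** (`decide`). [folklore] -/
theorem nodd_fortyFive_eq : Nodd45 = ({1, 4, 8, 13, 16, 19, 23, 28, 31, 34, 38, 43} : Finset (ZMod 45)) := by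
  decide

/-! #### Level `45`, the type `𝔣₀` with `𝔬𝔣₀ = (π)`, `π = ζ^42(1 − ζ^5)(1 − ζ^1)` (`ζ^5` a primitive `9`-th root of unity: `(π) = (1 − ζ^5)`, `(π)^6 = (3)`) -/

/-- the semi-admissibility of `x = (5, 1, 42)` at level `45` (`45 ∤ 5, 1`; `2·42 + 5 + 1 ≡ 0 (mod 90)`). [folklore] -/
theorem adm_fortyFive : ¬ 45 ∣ ((5, 1, 42) : ℕ × ℕ × ℕ).1 ∧ ¬ 45 ∣ ((5, 1, 42) : ℕ × ℕ × ℕ).2.1 ∧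
    (2 * ((5, 1, 42) : ℕ × ℕ × ℕ).2.2 + ((5, 1, 42) : ℕ × ℕ × ℕ).1 + ((5, 1, 42) : ℕ × ℕ × ℕ).2.1) % (2 * 45) = 0 := by
  decide

/-- **The twisted sign set at level `45` for `π = ζ^42(1 − ζ^5)(1 − ζ^1)`: `X_π = N_odd ∆ A_π = [2, 7, 13, 16, 22, 26, 28, 31, 34, 37, 41, 44]`** (`A_π = [1, 2, 4, 7, 8, 19, 22, 23, 26, 37, 38, 41, 43, 44]`, `|A_π|/2 = 7`;
`decide`).
research route conditional on HC_CM; not a corollary; Q11.4-sentence-2 already refuted in dim ≥ 3. [folklore] -/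
theorem twistSet_fortyFive : Xtw45 ((5, 1, 42) : ℕ × ℕ × ℕ) = ({2, 7, 13, 16, 22, 26, 28, 31, 34, 37, 41, 44} : Finset (ZMod 45)) := by
  decide

/-- **A type `𝔣₀ ⊆ 𝓞 K⁺` with `𝔬𝔣₀ = (π)`, `π = ζ^42(1 − ζ^5)(1 − ζ^1)`, EXISTS** (part 48 `exists_ideal_map_eq_span_gen`).
research route conditional on HC_CM; not a corollary; Q11.4-sentence-2 already refuted in dim ≥ 3. [cite: Shimura1998, §14.3, p. 103] -/
theorem exists_type_ideal_fortyFive [IsCMField K] (hζ : IsPrimitiveRoot ζ 45) :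
    ∃ 𝔣₀ : Ideal (𝓞 (maximalRealSubfield K)),
      𝔣₀.map (algebraMap (𝓞 (maximalRealSubfield K)) (𝓞 K)) = Ideal.span {hζ.toInteger ^ 42 * (1 - hζ.toInteger ^ 5) * (1 - hζ.toInteger ^ 1)} :=
  exists_ideal_map_eq_span_gen (x := ((5, 1, 42) : ℕ × ℕ × ℕ)) hζ adm_fortyFive

omit [NumberField K] in
/-- **`(𝔬𝔣₀)^6 = (3)`** for the type `𝔣₀` with `𝔬𝔣₀ = (π)`, `π = ζ^42(1 − ζ^5)(1 − ζ^1)`: `(π) = (1 − ζ^5)` (the factors `ζ^42`,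
`1 − ζ^1` are units, part 13) and `(1 − ζ^5)^6 = (3)` (part 48c, `ζ^5` a primitive `9`-th root of unity) — so
`N(𝔬𝔣₀) = 3^4`, `N_{K⁺/ℚ}(𝔣₀) = 3^2`: a polarisation of type `𝔣₀` on `ℂ^Φ/Φ(ℤ[ζ_45])` has degree `9`.
research route conditional on HC_CM; not a corollary; Q11.4-sentence-2 already refuted in dim ≥ 3. [cite: Washington1997, Lemma 1.4, Prop. 2.8] -/
theorem map_type_pow_fortyFive (hζ : IsPrimitiveRoot ζ 45) {𝔣₀ : Ideal (𝓞 (maximalRealSubfield K))}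
    (h𝔣₀ : 𝔣₀.map (algebraMap (𝓞 (maximalRealSubfield K)) (𝓞 K)) = Ideal.span {hζ.toInteger ^ 42 * (1 - hζ.toInteger ^ 5) * (1 - hζ.toInteger ^ 1)}) :
    𝔣₀.map (algebraMap (𝓞 (maximalRealSubfield K)) (𝓞 K)) ^ 6 = Ideal.span {(3 : 𝓞 K)} := by
  have hη : IsPrimitiveRoot (ζ ^ 5) 9 := hζ.pow (by norm_num) (by norm_num)
  have hηint : hη.toInteger = hζ.toInteger ^ 5 := RingOfIntegers.ext (by simp [IsPrimitiveRoot.toInteger])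
  have hu1 : IsUnit (hζ.toInteger ^ 42 : 𝓞 K) := (hζ.toInteger_isPrimitiveRoot.isUnit (by norm_num)).pow 42
  have hu2 : IsUnit (1 - hζ.toInteger ^ 1 : 𝓞 K) := isUnit_one_sub_toInteger_pow hζ (by decide) (by decide +kernel)
  rw [h𝔣₀, Ideal.span_singleton_mul_right_unit hu2, Ideal.span_singleton_mul_left_unit hu1, ← hηint]
  exact span_one_sub_pow_eq_nine hη

open scoped Classical in
/-- **CENSUS ROW `(ℚ(ζ_45), ℚ(√−3))` (a NO row for principal polarisations) — the RAMIFIED TYPE EXISTS: for every CM type `Φ`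
of `ℚ(ζ_45)` balanced for `N_K = [2, 8, 11, 14, 17, 23, 26, 29, 32, 38, 41, 44]` (the Weil signature `(6,6)` on `K = ℚ(√−3)`) and every type `𝔣₀` with
`𝔬𝔣₀ = (π)`, `π = ζ^42(1 − ζ^5)(1 − ζ^1)`, the principal CM torus `ℂ^Φ/Φ(ℤ[ζ_45])` CARRIES a `Φ`-positive divisor `X_ζ′` of type
`(K; Φ; 𝔣₀)`** — `ζ′^ρ = −ζ′`, `Im φ(ζ′) > 0` on `Φ`, `IsOfType 1 ζ′ 𝔣₀` [Sh98 §14.3 Prop. 4: a polarisation whose `φ_X` is the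
`𝔬𝔣₀`-multiplication, of degree `9`].  Proof: part 48 `exists_type_of_even` + THEOREM L (ii) at `45` + the residue count
`|S_Φ ∩ X_π| ≡ |X_π ∖ N_K| + g/2 = 8 + 6 ≡ 0`.
research route conditional on HC_CM; not a corollary; Q11.4-sentence-2 already refuted in dim ≥ 3. [cite: Shimura1998, §14.3 Prop. 4–5, pp. 103–104] -/
theorem exists_type_fortyFive_sqrt_neg_three [IsCMField K] [IsCyclotomicExtension {45} ℚ K] (hζ : IsPrimitiveRoot ζ 45)
    (Φ : CMType K) (hbal : 2 * (SΦ[Φ, ζ] ∩ ({2, 8, 11, 14, 17, 23, 26, 29, 32, 38, 41, 44} : Finset (ZMod 45))).card = (SΦ[Φ, ζ]).card)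
    {𝔣₀ : Ideal (𝓞 (maximalRealSubfield K))}
    (h𝔣₀ : 𝔣₀.map (algebraMap (𝓞 (maximalRealSubfield K)) (𝓞 K)) = Ideal.span {hζ.toInteger ^ 42 * (1 - hζ.toInteger ^ 5) * (1 - hζ.toInteger ^ 1)}) :
    ∃ ζ' : K, IsCMField.complexConj K ζ' = -ζ' ∧ (∀ φ : Φ.1, 0 < (φ.1 ζ').im) ∧
        CMTypeLattice.IsOfType (1 : (FractionalIdeal (𝓞 K)⁰ K)ˣ) ζ' 𝔣₀ := by
  have hg : Nat.totient 45 = 2 * (11 + 1) := by decide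
  refine exists_type_of_even hζ hg adm_fortyFive Φ h𝔣₀ (exists_units_sign_eq_fortyFive hζ Φ) ?_
  rw [twistSet_fortyFive]
  have hS := isCMTypeSet_residueFilter hζ Φ
  have hX : IsCMTypeSet 45 ({2, 7, 13, 16, 22, 26, 28, 31, 34, 37, 41, 44} : Finset (ZMod 45)) := by decide
  have hNK : IsCMTypeSet 45 ({2, 8, 11, 14, 17, 23, 26, 29, 32, 38, 41, 44} : Finset (ZMod 45)) := by decide
  have h1 := card_inter_mod_two_eq hS hX hNK
  have h2 := two_mul_card_eq_card_units hS
  have hU : (Finset.univ.filter fun t : ZMod 45 => t.val.Coprime 45).card = 24 := by decide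
  have h3 : (({2, 7, 13, 16, 22, 26, 28, 31, 34, 37, 41, 44} : Finset (ZMod 45)) \ ({2, 8, 11, 14, 17, 23, 26, 29, 32, 38, 41, 44} : Finset (ZMod 45))).card = 8 := by decide
  rw [Nat.even_iff]
  omega

open scoped Classical in
/-- **CENSUS ROW `(ℚ(ζ_45), ℚ(√−3))`, headline form: there is a type `𝔣₀ ⊆ 𝓞 K⁺` with `(𝔬𝔣₀)^6 = (3)` such that
`ℂ^Φ/Φ(ℤ[ζ_45])` carries a `Φ`-positive divisor of type `(K; Φ; 𝔣₀)`** for every `K`-balanced CM type `Φ`, `K = ℚ(√−3)`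
(polarisation degree `9`; the census's NO row gets an explicit NON-principal polarisation).
research route conditional on HC_CM; not a corollary; Q11.4-sentence-2 already refuted in dim ≥ 3. [cite: Shimura1998, §14.3 Prop. 4–5, pp. 103–104] -/
theorem exists_ramifiedType_fortyFive_sqrt_neg_three [IsCMField K] [IsCyclotomicExtension {45} ℚ K]
    (hζ : IsPrimitiveRoot ζ 45) (Φ : CMType K) (hbal : 2 * (SΦ[Φ, ζ] ∩ ({2, 8, 11, 14, 17, 23, 26, 29, 32, 38, 41, 44} : Finset (ZMod 45))).card = (SΦ[Φ, ζ]).card) :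
    ∃ 𝔣₀ : Ideal (𝓞 (maximalRealSubfield K)),
      𝔣₀.map (algebraMap (𝓞 (maximalRealSubfield K)) (𝓞 K)) ^ 6 = Ideal.span {(3 : 𝓞 K)} ∧
      ∃ ζ' : K, IsCMField.complexConj K ζ' = -ζ' ∧ (∀ φ : Φ.1, 0 < (φ.1 ζ').im) ∧
        CMTypeLattice.IsOfType (1 : (FractionalIdeal (𝓞 K)⁰ K)ˣ) ζ' 𝔣₀ := by
  obtain ⟨𝔣₀, h𝔣₀⟩ := exists_type_ideal_fortyFive hζ
  exact ⟨𝔣₀, map_type_pow_fortyFive hζ h𝔣₀, exists_type_fortyFive_sqrt_neg_three hζ Φ hbal h𝔣₀⟩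

open scoped Classical in
/-- **CENSUS ROW `(ℚ(ζ_45), ℚ(√−15))` (a NO row for principal polarisations) — the RAMIFIED TYPE EXISTS: for every CM type `Φ`
of `ℚ(ζ_45)` balanced for `N_K = [7, 11, 13, 14, 22, 26, 28, 29, 37, 41, 43, 44]` (the Weil signature `(6,6)` on `K = ℚ(√−15)`) and every type `𝔣₀` with
`𝔬𝔣₀ = (π)`, `π = ζ^42(1 − ζ^5)(1 − ζ^1)`, the principal CM torus `ℂ^Φ/Φ(ℤ[ζ_45])` CARRIES a `Φ`-positive divisor `X_ζ′` of type
`(K; Φ; 𝔣₀)`** — `ζ′^ρ = −ζ′`, `Im φ(ζ′) > 0` on `Φ`, `IsOfType 1 ζ′ 𝔣₀` [Sh98 §14.3 Prop. 4: a polarisation whose `φ_X` is the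
`𝔬𝔣₀`-multiplication, of degree `9`].  Proof: part 48 `exists_type_of_even` + THEOREM L (ii) at `45` + the residue count
`|S_Φ ∩ X_π| ≡ |X_π ∖ N_K| + g/2 = 4 + 6 ≡ 0`.
research route conditional on HC_CM; not a corollary; Q11.4-sentence-2 already refuted in dim ≥ 3. [cite: Shimura1998, §14.3 Prop. 4–5, pp. 103–104] -/
theorem exists_type_fortyFive_sqrt_neg_fifteen [IsCMField K] [IsCyclotomicExtension {45} ℚ K] (hζ : IsPrimitiveRoot ζ 45)
    (Φ : CMType K) (hbal : 2 * (SΦ[Φ, ζ] ∩ ({7, 11, 13, 14, 22, 26, 28, 29, 37, 41, 43, 44} : Finset (ZMod 45))).card = (SΦ[Φ, ζ]).card)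
    {𝔣₀ : Ideal (𝓞 (maximalRealSubfield K))}
    (h𝔣₀ : 𝔣₀.map (algebraMap (𝓞 (maximalRealSubfield K)) (𝓞 K)) = Ideal.span {hζ.toInteger ^ 42 * (1 - hζ.toInteger ^ 5) * (1 - hζ.toInteger ^ 1)}) :
    ∃ ζ' : K, IsCMField.complexConj K ζ' = -ζ' ∧ (∀ φ : Φ.1, 0 < (φ.1 ζ').im) ∧
        CMTypeLattice.IsOfType (1 : (FractionalIdeal (𝓞 K)⁰ K)ˣ) ζ' 𝔣₀ := by
  have hg : Nat.totient 45 = 2 * (11 + 1) := by decide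
  refine exists_type_of_even hζ hg adm_fortyFive Φ h𝔣₀ (exists_units_sign_eq_fortyFive hζ Φ) ?_
  rw [twistSet_fortyFive]
  have hS := isCMTypeSet_residueFilter hζ Φ
  have hX : IsCMTypeSet 45 ({2, 7, 13, 16, 22, 26, 28, 31, 34, 37, 41, 44} : Finset (ZMod 45)) := by decide
  have hNK : IsCMTypeSet 45 ({7, 11, 13, 14, 22, 26, 28, 29, 37, 41, 43, 44} : Finset (ZMod 45)) := by decide
  have h1 := card_inter_mod_two_eq hS hX hNK
  have h2 := two_mul_card_eq_card_units hS
  have hU : (Finset.univ.filter fun t : ZMod 45 => t.val.Coprime 45).card = 24 := by decide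
  have h3 : (({2, 7, 13, 16, 22, 26, 28, 31, 34, 37, 41, 44} : Finset (ZMod 45)) \ ({7, 11, 13, 14, 22, 26, 28, 29, 37, 41, 43, 44} : Finset (ZMod 45))).card = 4 := by decide
  rw [Nat.even_iff]
  omega

open scoped Classical in
/-- **CENSUS ROW `(ℚ(ζ_45), ℚ(√−15))`, headline form: there is a type `𝔣₀ ⊆ 𝓞 K⁺` with `(𝔬𝔣₀)^6 = (3)` such that
`ℂ^Φ/Φ(ℤ[ζ_45])` carries a `Φ`-positive divisor of type `(K; Φ; 𝔣₀)`** for every `K`-balanced CM type `Φ`, `K = ℚ(√−15)`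
(polarisation degree `9`; the census's NO row gets an explicit NON-principal polarisation).
research route conditional on HC_CM; not a corollary; Q11.4-sentence-2 already refuted in dim ≥ 3. [cite: Shimura1998, §14.3 Prop. 4–5, pp. 103–104] -/
theorem exists_ramifiedType_fortyFive_sqrt_neg_fifteen [IsCMField K] [IsCyclotomicExtension {45} ℚ K]
    (hζ : IsPrimitiveRoot ζ 45) (Φ : CMType K) (hbal : 2 * (SΦ[Φ, ζ] ∩ ({7, 11, 13, 14, 22, 26, 28, 29, 37, 41, 43, 44} : Finset (ZMod 45))).card = (SΦ[Φ, ζ]).card) :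
    ∃ 𝔣₀ : Ideal (𝓞 (maximalRealSubfield K)),
      𝔣₀.map (algebraMap (𝓞 (maximalRealSubfield K)) (𝓞 K)) ^ 6 = Ideal.span {(3 : 𝓞 K)} ∧
      ∃ ζ' : K, IsCMField.complexConj K ζ' = -ζ' ∧ (∀ φ : Φ.1, 0 < (φ.1 ζ').im) ∧
        CMTypeLattice.IsOfType (1 : (FractionalIdeal (𝓞 K)⁰ K)ˣ) ζ' 𝔣₀ := by
  obtain ⟨𝔣₀, h𝔣₀⟩ := exists_type_ideal_fortyFive hζ
  exact ⟨𝔣₀, map_type_pow_fortyFive hζ h𝔣₀, exists_type_fortyFive_sqrt_neg_fifteen hζ Φ hbal h𝔣₀⟩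

open scoped Classical in
/-- **DICHOTOMY AT LEVEL `45`: every one of the `2^12` CM types `Φ` of `ℚ(ζ_45)` makes `ℂ^Φ/Φ(ℤ[ζ_45])` carry EITHER an
`ι`-compatible principal polarisation OR a `Φ`-positive divisor of the ramified type `𝔣₀` (`𝔬𝔣₀ = (π)`, `π = ζ^42(1 − ζ^5)(1 − ζ^1)`),
NEVER BOTH** — `|N_odd ∖ X_π| = |A_π|/2 = 7` is odd (equivalently `N_{K⁺/ℚ}(π) < 0`), THEOREM L (i)/(ii) at `45`, part 48
`exists_principal_xor_exists_type`.
research route conditional on HC_CM; not a corollary; Q11.4-sentence-2 already refuted in dim ≥ 3. [cite: Shimura1998, §14.3 Prop. 5, p. 104] -/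
theorem exists_principal_xor_type_fortyFive [IsCMField K] [IsCyclotomicExtension {45} ℚ K] (hζ : IsPrimitiveRoot ζ 45)
    (Φ : CMType K) {𝔣₀ : Ideal (𝓞 (maximalRealSubfield K))}
    (h𝔣₀ : 𝔣₀.map (algebraMap (𝓞 (maximalRealSubfield K)) (𝓞 K)) = Ideal.span {hζ.toInteger ^ 42 * (1 - hζ.toInteger ^ 5) * (1 - hζ.toInteger ^ 1)}) :
    Xor (∃ ζ' : K, IsCMField.complexConj K ζ' = -ζ' ∧ (∀ φ : Φ.1, 0 < (φ.1 ζ').im) ∧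
          CMTypeLattice.IsOfType (1 : (FractionalIdeal (𝓞 K)⁰ K)ˣ) ζ' ⊤)
      (∃ ζ' : K, IsCMField.complexConj K ζ' = -ζ' ∧ (∀ φ : Φ.1, 0 < (φ.1 ζ').im) ∧
          CMTypeLattice.IsOfType (1 : (FractionalIdeal (𝓞 K)⁰ K)ˣ) ζ' 𝔣₀) := by
  have hg : Nat.totient 45 = 2 * (11 + 1) := by decide
  refine exists_principal_xor_exists_type hζ hg adm_fortyFive Φ h𝔣₀ (norm_realUnits_pos_fortyFive hζ)
    (exists_units_sign_eq_fortyFive hζ Φ) ?_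
  rw [twistSet_fortyFive, nodd_fortyFive_eq]
  have hS := isCMTypeSet_residueFilter hζ Φ
  have hN : IsCMTypeSet 45 ({1, 4, 8, 13, 16, 19, 23, 28, 31, 34, 38, 43} : Finset (ZMod 45)) := by decide
  have hX : IsCMTypeSet 45 ({2, 7, 13, 16, 22, 26, 28, 31, 34, 37, 41, 44} : Finset (ZMod 45)) := by decide
  have h := card_inter_add_card_inter_eq hS hN hX
  have hd : (({1, 4, 8, 13, 16, 19, 23, 28, 31, 34, 38, 43} : Finset (ZMod 45)) \ ({2, 7, 13, 16, 22, 26, 28, 31, 34, 37, 41, 44} : Finset (ZMod 45))).card = 7 := by decide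
  omega

end Level45

end Summit.HodgeConjecture.Ring2WeilCoverage.RamifiedTypesLevels35and45

end
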